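import Summits.AnomalousDissipation.AnomalousDissipation.Theorems.GalerkinInvariantLoud.Negative.Absorbing
import Summits.AnomalousDissipation.AnomalousDissipation.Theorems.MomentParityGalerkinLiouville
import Literature.Analysis.FluidPDE.GalerkinFlow

/-!
# Helper A for stub `stub_krylovBogoliubov` of the line `taylor-cone-homogenisation`
# (crux stmt-AnomalousDissipation-14283, `MomentParity.GalerkinInvariantLoud`): the Galerkin orbit lifted to `H`

Orbit facts for ONE global solution `c : ℝ → (freqBall N → ℂ³)` of the level-`N` Galerkin system of the
Navier–Stokes equations on `T³` with a steady force `f` (`IsGalerkinODESolution ν f̂|_{≤N} â|_{≤N} c`,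
`GalerkinFlow.lean`; the concrete orbit is `t ↦ galerkinCoeffFlow ν f̂|_{≤N} t â|_{≤N}`, constant `= â|_{≤N}` at
negative times), written so that the Krylov–Bogoliubov construction of the stub can push the orbit to the
energy space `H = L²_σ`:

* `apply_zero_of_isGalerkinODESolution` — the mean mode is conserved: `c t 0 = 0` for mean-zero `a`, `f`
  (`galerkinRHS_apply_zero` + `constant_of_has_deriv_right_zero`);
* `continuous_synth` — the synthesis map `c ↦ [realTrigPoly (freqBall N) c̄] ∈ L²` is continuous (linear on a
  finite-dimensional space); the LIFT `U t = ⟨[realTrigPoly c̄(t)], _⟩ ∈ H` (`toLp_realTrigPoly_mem_energySpace`) is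
  handled through the hypothesis `hU : ∀ t, (U t).1 = [realTrigPoly c̄(t)]` (no new definitions in this file):
  `isLevel_lift`, `norm_lift_sq`, `pairing_lift`, `fourierRestrict_lift`, `eGradNormSq_realTrigPoly_eq_lift`, `continuous_lift`;
* `energy_le_of_isGalerkinODESolution` / `krylovBogoliubov_orbitEnergyBound` (the registered sub-goal, stated for the
  concrete orbit `galerkinCoeffFlow`) — the UNIFORM energy bound `Σ‖c t k‖² ≤ max (Σ‖â k‖²) (‖f‖₂²/(4π²ν)²)`
  (energy identity in differential form `hasDerivWithinAt_energy`, Poincaré on the punctured ball, Young, and the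
  constant upper barrier `image_le_of_deriv_right_lt_deriv_boundary'`).

All statements are folklore (Constantin–Foias 1988 Ch. 8; Robinson–Rodrigo–Sadowski 2016 Thm. 4.4; FMRT 2001 Ch. IV
App. B for the Galerkin Krylov–Bogoliubov procedure).
-/

set_option linter.dupNamespace false

noncomputable section

namespace Summit.AnomalousDissipation.AnomalousDissipation.Theorems.GalerkinInvariantLoud.KrylovBogoliubov

open MeasureTheory Filter Topology Set UnitAddTorus
open scoped ENNReal InnerProductSpace RealInnerProductSpace
open Literature.Analysis.FunctionSpaces Literature.Analysis.FluidPDE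
open Summit.AnomalousDissipation.AnomalousDissipation.Theses.MomentParity
open Summit.AnomalousDissipation.AnomalousDissipation.Theorems.QuarticGate.Negative
open Summit.AnomalousDissipation.AnomalousDissipation.Theorems.CubicParityLoud.Negative (T3 R3 H3 L2T3)
open Summit.AnomalousDissipation.AnomalousDissipation.Theorems.MomentParity
  (galerkinRHS_apply_zero toLp_realTrigPoly_mem_energySpace pairing_eq_sum_re_inner)

variable {ν : ℝ} {f a : T3 → R3} {N : ℕ} {c : ℝ → ↥(Torus.freqBall (d := Fin 3) N) → EuclideanSpace ℂ (Fin 3)}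

/-! ## The coefficient orbit: negative times, continuity, the mean mode -/

/-- A global Galerkin solution which is the datum at negative times (the junk convention of
`galerkinCoeffFlow`) is continuous on `ℝ`. [folklore] -/
theorem continuous_of_isGalerkinODESolution
    (hc : IsGalerkinODESolution ν (fourierRestrict (Torus.freqBall N) f) (fourierRestrict (Torus.freqBall N) a) c)
    (hneg : ∀ t, t ≤ 0 → c t = fourierRestrict (Torus.freqBall N) a) : Continuous c := by
  have h2 : ContinuousOn c (Iic 0) := continuousOn_const.congr fun t ht => hneg t ht
  have h := h2.union_of_isClosed hc.continuousOn isClosed_Iic isClosed_Ici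
  rwa [Iic_union_Ici, continuousOn_univ] at h

/-- The concrete orbit `t ↦ φ_t(â|_{≤N})` is the datum at nonpositive times. [folklore] -/
theorem galerkinCoeffFlow_of_nonpos {t : ℝ} (ht : t ≤ 0) :
    galerkinCoeffFlow ν (fourierRestrict (Torus.freqBall N) f) t (fourierRestrict (Torus.freqBall N) a) = fourierRestrict (Torus.freqBall N) a := by
  rcases ht.lt_or_eq with ht | rfl
  · exact galerkinCoeffFlow_of_neg ht _
  · exact galerkinCoeffFlow_zero _

/-- **The mean mode is conserved**: `c t 0 = 0` along a global Galerkin solution from a mean-zero datum with a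
mean-zero force (the Galerkin field has no mean mode, `galerkinRHS_apply_zero`). [folklore] -/
theorem apply_zero_of_isGalerkinODESolution (hf : Integrable f volume) (hf0 : Torus.HasZeroMean f)
    (ha : IsGalerkinMode N a) (ha0 : Torus.HasZeroMean a)
    (hc : IsGalerkinODESolution ν (fourierRestrict (Torus.freqBall N) f) (fourierRestrict (Torus.freqBall N) a) c)
    (hneg : ∀ t, t ≤ 0 → c t = fourierRestrict (Torus.freqBall N) a) (t : ℝ) :
    c t ⟨0, Torus.zero_mem_freqBall N⟩ = 0 := by
  set k0 : ↥(Torus.freqBall (d := Fin 3) N) := ⟨0, Torus.zero_mem_freqBall N⟩ with hk0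
  have h0 : fourierRestrict (Torus.freqBall N) a k0 = 0 := by
    rw [fourierRestrict_apply]
    exact Torus.mFourierCoeff_complexify_zero_of_hasZeroMean ha.isSmooth.integrable ha0
  rcases le_or_gt t 0 with ht | ht
  · rw [hneg t ht]; exact h0
  · have hcont : ContinuousOn (fun τ => c τ k0) (Icc 0 t) :=
      ((continuous_apply k0).comp (continuous_of_isGalerkinODESolution hc hneg)).continuousOn
    have hder : ∀ x ∈ Ico 0 t, HasDerivWithinAt (fun τ => c τ k0) 0 (Ici x) x := by
      intro x hx
      have h1 := hc.hasDerivWithinAt_Ici hx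
      have h2 := ((ContinuousLinearMap.proj (R := ℝ) (φ := fun _ : ↥(Torus.freqBall (d := Fin 3) N) => EuclideanSpace ℂ (Fin 3))
        k0).hasFDerivAt.comp_hasDerivWithinAt x h1)
      have h3 : galerkinRHS (Torus.freqBall N) ν (fourierRestrict (Torus.freqBall N) f) (c x) k0 = 0 :=
        galerkinRHS_apply_zero ν hf hf0 (hc.mem x)
      simpa [Function.comp_def, h3] using h2
    rw [constant_of_has_deriv_right_zero hcont hder t ⟨ht.le, le_rfl⟩]
    show c 0 k0 = 0
    rw [hc.initial]; exact h0

/-! ## The synthesis map and the lift to `H` -/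

-- adapted from Literature/Analysis/FunctionSpaces/TorusWeightedGalerkinCoefficients.lean (`realTrigPoly_smul`)
/-- `realTrigPoly` commutes with real scalars in the coefficients. [folklore] -/
theorem realTrigPoly_smul' (S : Finset (Fin 3 → ℤ)) (r : ℝ) (C : (Fin 3 → ℤ) → EuclideanSpace ℂ (Fin 3)) :
    Torus.realTrigPoly S (r • C) = r • Torus.realTrigPoly S C := by
  have h : r • C = (r : ℂ) • C := by
    funext k; simp only [Pi.smul_apply, Complex.coe_smul]
  funext x
  rw [Pi.smul_apply, Torus.realTrigPoly_apply, Torus.realTrigPoly_apply, h, Torus.trigPoly_smul, Pi.smul_apply,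
    Complex.coe_smul, map_smul]

/-- **The synthesis map is continuous**: `c ↦ [realTrigPoly (freqBall N) c̄] ∈ L²(T³)` is `ℝ`-linear on the
finite-dimensional coefficient space, hence continuous. [folklore] -/
theorem continuous_synth (N : ℕ) : Continuous fun c : ↥(Torus.freqBall (d := Fin 3) N) → EuclideanSpace ℂ (Fin 3) =>
    ((Torus.memLp_realTrigPoly (Torus.freqBall N) (Torus.coeffExt (Torus.freqBall N) c) 2).toLp _ : L2T3) := by
  let L : (↥(Torus.freqBall (d := Fin 3) N) → EuclideanSpace ℂ (Fin 3)) →ₗ[ℝ] L2T3 :=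
    { toFun := fun c => (Torus.memLp_realTrigPoly (Torus.freqBall N) (Torus.coeffExt (Torus.freqBall N) c) 2).toLp _
      map_add' := fun c c' => by
        rw [← MemLp.toLp_add]
        refine MemLp.toLp_congr _ _ (Eventually.of_forall fun x => ?_)
        rw [Torus.coeffExt_add, Torus.realTrigPoly_add]
      map_smul' := fun r c => by
        simp only [RingHom.id_apply]
        rw [← MemLp.toLp_const_smul]
        refine MemLp.toLp_congr _ _ (Eventually.of_forall fun x => ?_)
        rw [Torus.coeffExt_smul, realTrigPoly_smul'] }
  exact L.continuous_of_finiteDimensional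

section Lift

variable {U : ℝ → H3} (hU : ∀ t, (U t).1 = (Torus.memLp_realTrigPoly (Torus.freqBall N) (Torus.coeffExt (Torus.freqBall N) (c t)) 2).toLp _)
include hU

/-- The lift `U t = [realTrigPoly c̄(t)]` is a.e. the real trigonometric polynomial of the coefficients. [folklore] -/
theorem coe_lift_ae_eq (t : ℝ) :
    ((U t).1 : T3 → R3) =ᵐ[volume] Torus.realTrigPoly (Torus.freqBall N) (Torus.coeffExt (Torus.freqBall N) (c t)) := by
  rw [hU t]
  exact MemLp.coeFn_toLp (Torus.memLp_realTrigPoly (Torus.freqBall N) (Torus.coeffExt (Torus.freqBall N) (c t)) 2)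

/-- The lift is continuous when the coefficient path is. [folklore] -/
theorem continuous_lift (hcont : Continuous c) : Continuous U := by
  have h1 : Continuous fun t => (U t).1 := by
    have : (fun t => (U t).1) = fun t =>
        ((Torus.memLp_realTrigPoly (Torus.freqBall N) (Torus.coeffExt (Torus.freqBall N) (c t)) 2).toLp _ : L2T3) := funext hU
    rw [this]
    exact (continuous_synth N).comp hcont
  exact continuous_induced_rng.2 h1

variable (hcm : ∀ t, c t ∈ galerkinSubspace (Torus.freqBall N)) (h0 : ∀ t, c t ⟨0, Torus.zero_mem_freqBall N⟩ = 0)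
include hcm h0

/-- Fourier coefficients of the lift: `Û(t)(k) = c̄(t)(k)`. [folklore] -/
theorem mFourierCoeff_lift (t : ℝ) (k : Fin 3 → ℤ) : mFourierCoeff (EuclideanSpace.complexify ∘ ((U t).1 : T3 → R3)) k = Torus.coeffExt (Torus.freqBall N) (c t) k := by
  rw [hU t]
  exact (toLp_realTrigPoly_mem_energySpace (hcm t) (h0 t)).2 k

/-- The lift is level-`N`. [folklore] -/
theorem isLevel_lift (t : ℝ) : IsLevel N (U t) := by
  intro k hk
  rw [mFourierCoeff_lift hU hcm h0]
  by_cases hkS : k ∈ Torus.freqBall N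
  · have hk0 : k = 0 := by
      by_contra h
      exact hk (Finset.mem_erase.2 ⟨h, hkS⟩)
    subst hk0
    rw [Torus.coeffExt_of_mem _ hkS]
    exact h0 t
  · exact Torus.coeffExt_of_not_mem _ hkS

omit h0 in
/-- Norm of the lift: `‖U t‖² = Σ_k ‖c t k‖²` (finite Parseval). [folklore] -/
theorem norm_lift_sq (t : ℝ) : ‖U t‖ ^ 2 = ∑ k, ‖c t k‖ ^ 2 := by
  have h1 : ‖U t‖ ^ 2 = ∫ x, ‖((U t).1 : T3 → R3) x‖ ^ 2 := (Torus.integral_norm_sq_coe_eq _).symm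
  rw [h1, integral_congr_ae ((coe_lift_ae_eq hU t).mono fun x hx => by rw [hx]),
    Torus.integral_norm_sq_realTrigPoly Torus.neg_mem_freqBall_of_mem
      ((hcm t).1.isConjSymm_coeffExt Torus.neg_mem_freqBall_of_mem),
    Torus.sum_coeffExt (fun _ v => ‖v‖ ^ 2)]

/-- Pairing of the lift with a field band-limited to the ball: `(U t, b) = Σ_k Re⟪c t k, b̂ k⟫`. [folklore] -/
theorem pairing_lift {b : T3 → R3} (hb2 : MemLp b 2 volume) (hb : ∀ k ∉ Torus.freqBall N, mFourierCoeff (EuclideanSpace.complexify ∘ b) k = 0) (t : ℝ) :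
    Torus.pairing (U t).1 b = ∑ k : ↥(Torus.freqBall (d := Fin 3) N), (inner ℂ (c t k) (mFourierCoeff (EuclideanSpace.complexify ∘ b) k)).re := by
  rw [pairing_eq_sum_re_inner _ hb2 hb]
  simp_rw [mFourierCoeff_lift hU hcm h0]
  exact Torus.sum_coeffExt (fun k v => (inner ℂ v (mFourierCoeff (EuclideanSpace.complexify ∘ b) k)).re) (c t)

/-- The restricted Fourier coefficients of the lift are the coefficients. [folklore] -/
theorem fourierRestrict_lift (t : ℝ) : fourierRestrict (Torus.freqBall N) ((U t).1 : T3 → R3) = c t := by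
  funext k
  rw [fourierRestrict_apply, mFourierCoeff_lift hU hcm h0, Torus.coeffExt_coe]

/-- The spectral enstrophy of the trigonometric polynomial is the (continuous) band enstrophy of the lift:
`‖∇ realTrigPoly c̄(t)‖² = 4π² Σ_{k ∈ ball} |k|² ‖Û(t)(k)‖²`. [folklore] -/
theorem eGradNormSq_realTrigPoly_eq_lift (t : ℝ) :
    Torus.eGradNormSq (Torus.realTrigPoly (Torus.freqBall N) (Torus.coeffExt (Torus.freqBall N) (c t))) =
      ENNReal.ofReal (4 * Real.pi ^ 2 * ∑ k ∈ Torus.freqBall N, Torus.freqNormSq k * ‖mFourierCoeff (EuclideanSpace.complexify ∘ ((U t).1 : T3 → R3)) k‖ ^ 2) := by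
  rw [Torus.eGradNormSq_realTrigPoly Torus.neg_mem_freqBall_of_mem
    ((hcm t).1.isConjSymm_coeffExt Torus.neg_mem_freqBall_of_mem)]
  simp_rw [mFourierCoeff_lift hU hcm h0]

end Lift

/-! ## The uniform energy bound along the orbit -/

/-- **Poincaré on the punctured ball**: for a coefficient vector with no mean mode,
`Σ_{k ∈ ball} ‖c̄ k‖² ≤ Σ_{k ∈ ball} |k|² ‖c̄ k‖²`. [folklore] -/
theorem sum_norm_sq_le_sum_freqNormSq_mul {w : ↥(Torus.freqBall (d := Fin 3) N) → EuclideanSpace ℂ (Fin 3)}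
    (h0 : w ⟨0, Torus.zero_mem_freqBall N⟩ = 0) :
    ∑ k ∈ Torus.freqBall N, ‖Torus.coeffExt (Torus.freqBall N) w k‖ ^ 2 ≤
      ∑ k ∈ Torus.freqBall N, Torus.freqNormSq k * ‖Torus.coeffExt (Torus.freqBall N) w k‖ ^ 2 := by
  refine Finset.sum_le_sum fun k hk => ?_
  by_cases hk0 : k = 0
  · subst hk0
    rw [Torus.coeffExt_of_mem _ hk, h0]
    simp
  · exact le_mul_of_one_le_left (sq_nonneg _) (Torus.one_le_freqNormSq hk0)

/-- Young's inequality for coefficient pairings: `2 Re⟪v, w⟫ ≤ λ‖w‖² + ‖v‖²/λ` (`λ > 0`). [folklore] -/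
theorem two_mul_re_inner_le {lam : ℝ} (hlam : 0 < lam) (v w : EuclideanSpace ℂ (Fin 3)) :
    2 * (inner ℂ v w).re ≤ lam * ‖w‖ ^ 2 + ‖v‖ ^ 2 / lam := by
  have h1 : (inner ℂ v w).re ≤ ‖v‖ * ‖w‖ := by simpa using re_inner_le_norm (𝕜 := ℂ) v w
  have h2 : 2 * (‖v‖ * ‖w‖) ≤ lam * ‖w‖ ^ 2 + ‖v‖ ^ 2 / lam := by
    rw [← sub_nonneg]
    have : lam * ‖w‖ ^ 2 + ‖v‖ ^ 2 / lam - 2 * (‖v‖ * ‖w‖) = (lam * ‖w‖ - ‖v‖) ^ 2 / lam := by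
      field_simp
      ring
    rw [this]
    positivity
  linarith

/-- **The energy inequality in differential form**: for a phase-space vector `w` with no mean mode and
real force coefficients `g`, the right-hand side of the energy identity obeys
`2(−ν‖∇u_w‖² + ∫⟪u_g, u_w⟫) ≤ −4π²ν Σ‖w k‖² + Σ‖g k‖²/(4π²ν)` (Poincaré + Young). [folklore] -/
theorem energy_rhs_le (hν : 0 < ν) {w g : ↥(Torus.freqBall (d := Fin 3) N) → EuclideanSpace ℂ (Fin 3)}
    (hwm : w ∈ galerkinSubspace (Torus.freqBall N)) (hw0 : w ⟨0, Torus.zero_mem_freqBall N⟩ = 0) (hg : Torus.IsRealCoeff g) :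
    2 * (-(ν * (Torus.eGradNormSq (Torus.realTrigPoly (Torus.freqBall N) (Torus.coeffExt (Torus.freqBall N) w))).toReal) +
        ∫ x, ⟪Torus.realTrigPoly (Torus.freqBall N) (Torus.coeffExt (Torus.freqBall N) g) x,
          Torus.realTrigPoly (Torus.freqBall N) (Torus.coeffExt (Torus.freqBall N) w) x⟫_ℝ) ≤
      -(4 * Real.pi ^ 2 * ν) * ∑ k, ‖w k‖ ^ 2 + (∑ k, ‖g k‖ ^ 2) / (4 * Real.pi ^ 2 * ν) := by
  have hS : ∀ k ∈ Torus.freqBall (d := Fin 3) N, -k ∈ Torus.freqBall N := Torus.neg_mem_freqBall_of_mem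
  have hlam : 0 < 4 * Real.pi ^ 2 * ν := by positivity
  have hsymm : Torus.IsConjSymm (Torus.coeffExt (Torus.freqBall N) w) := hwm.1.isConjSymm_coeffExt hS
  have hG : (4 * Real.pi ^ 2 * ν) * ∑ k, ‖w k‖ ^ 2 ≤
      ν * (Torus.eGradNormSq (Torus.realTrigPoly (Torus.freqBall N) (Torus.coeffExt (Torus.freqBall N) w))).toReal := by
    rw [Torus.toReal_eGradNormSq_realTrigPoly hS hsymm]
    have h1 := sum_norm_sq_le_sum_freqNormSq_mul hw0
    rw [Torus.sum_coeffExt (fun _ v => ‖v‖ ^ 2)] at h1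
    have : (4 * Real.pi ^ 2 * ν) * ∑ k, ‖w k‖ ^ 2 = ν * (4 * Real.pi ^ 2 * ∑ k, ‖w k‖ ^ 2) := by ring
    rw [this]
    exact mul_le_mul_of_nonneg_left (mul_le_mul_of_nonneg_left h1 (by positivity)) hν.le
  have hW : 2 * ∫ y, ⟪Torus.realTrigPoly (Torus.freqBall N) (Torus.coeffExt (Torus.freqBall N) g) y,
      Torus.realTrigPoly (Torus.freqBall N) (Torus.coeffExt (Torus.freqBall N) w) y⟫_ℝ ≤
        (4 * Real.pi ^ 2 * ν) * ∑ k, ‖w k‖ ^ 2 + (∑ k, ‖g k‖ ^ 2) / (4 * Real.pi ^ 2 * ν) := by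
    rw [Torus.integral_inner_realTrigPoly_realTrigPoly hS (hg.isConjSymm_coeffExt hS) hsymm,
      Torus.sum_coeffExt (fun k v => (inner ℂ v (Torus.coeffExt (Torus.freqBall N) w k)).re)]
    simp only [Torus.coeffExt_coe]
    rw [Finset.mul_sum, Finset.mul_sum, Finset.sum_div, ← Finset.sum_add_distrib]
    exact Finset.sum_le_sum fun k _ => two_mul_re_inner_le hlam _ _
  linarith

/-- **Constant upper barrier**: if `ψ` is continuous on `[0, T]` with right derivatives `ψ' ≤ −λψ + C` on `[0, T)`
(`λ > 0`), `ψ 0 ≤ M` and `C/λ ≤ M`, then `ψ ≤ M` on `[0, T]` (the barrier `M + δ` is never reached from below: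
`image_le_of_deriv_right_lt_deriv_boundary'`). [folklore] -/
theorem le_of_deriv_right_le {ψ ψ' : ℝ → ℝ} {T lam C M : ℝ} (hlam : 0 < lam) (hcont : ContinuousOn ψ (Icc 0 T))
    (hder : ∀ x ∈ Ico 0 T, HasDerivWithinAt ψ (ψ' x) (Ici x) x)
    (hineq : ∀ x ∈ Ico 0 T, ψ' x ≤ -lam * ψ x + C) (hψ0 : ψ 0 ≤ M) (hCM : C / lam ≤ M) {t : ℝ}
    (ht : t ∈ Icc 0 T) : ψ t ≤ M := by
  refine le_of_forall_pos_le_add fun δ hδ => ?_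
  have hbound : ∀ x ∈ Ico 0 T, ψ x = M + δ → ψ' x < 0 := by
    intro x hx hxM
    refine (hineq x hx).trans_lt ?_
    rw [hxM]
    rw [div_le_iff₀ hlam] at hCM
    nlinarith [mul_pos hlam hδ]
  exact image_le_of_deriv_right_lt_deriv_boundary' hcont hder (B := fun _ => M + δ) (B' := fun _ => 0)
    (by linarith) continuousOn_const (fun x _ => hasDerivWithinAt_const x _ _) hbound ht

/-- **Uniform energy bound** (absorbing ball in coefficients): for `ν > 0`, `f ∈ L²`, a global Galerkin solution
from `â|_{≤N}` with no mean mode (and equal to the datum at negative times) satisfies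
`Σ_k ‖c t k‖² ≤ max (Σ_k ‖â k‖²) (‖f‖₂² / (4π²ν)²)` for ALL `t`. [folklore] -/
theorem energy_le_of_isGalerkinODESolution (hν : 0 < ν) (hf2 : MemLp f 2 volume)
    (hc : IsGalerkinODESolution ν (fourierRestrict (Torus.freqBall N) f) (fourierRestrict (Torus.freqBall N) a) c)
    (hneg : ∀ t, t ≤ 0 → c t = fourierRestrict (Torus.freqBall N) a) (h0 : ∀ t, c t ⟨0, Torus.zero_mem_freqBall N⟩ = 0) (t : ℝ) :
    ∑ k, ‖c t k‖ ^ 2 ≤ max (∑ k, ‖fourierRestrict (Torus.freqBall N) a k‖ ^ 2) ((∫ x, ‖f x‖ ^ 2) / (4 * Real.pi ^ 2 * ν) ^ 2) := by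
  have hS : ∀ k ∈ Torus.freqBall (d := Fin 3) N, -k ∈ Torus.freqBall N := Torus.neg_mem_freqBall_of_mem
  have hfi : Integrable f volume := hf2.integrable one_le_two
  have hgr : Torus.IsRealCoeff (fourierRestrict (Torus.freqBall N) f) := Torus.isRealCoeff_mFourierCoeff hfi
  have hlam : 0 < 4 * Real.pi ^ 2 * ν := by positivity
  have hF2 : ∑ k, ‖fourierRestrict (Torus.freqBall N) f k‖ ^ 2 ≤ ∫ x, ‖f x‖ ^ 2 :=
    IsGalerkinTrajectory.sum_norm_sq_fourierRestrict_le _ hf2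
  -- nonpositive times: the datum
  rcases le_or_gt t 0 with ht | ht
  · rw [hneg t ht]
    exact le_max_left _ _
  -- positive times: the barrier lemma on `[0, t]`
  have h1 : Continuous fun w : ↥(Torus.freqBall (d := Fin 3) N) → EuclideanSpace ℂ (Fin 3) => ∑ k, ‖w k‖ ^ 2 :=
    continuous_finsetSum _ fun k _ => (continuous_apply k).norm.pow 2
  have hcont : ContinuousOn (fun τ => ∑ k, ‖c τ k‖ ^ 2) (Icc 0 t) :=
    (h1.comp (continuous_of_isGalerkinODESolution hc hneg)).continuousOn
  refine le_of_deriv_right_le (C := (∑ k, ‖fourierRestrict (Torus.freqBall N) f k‖ ^ 2) / (4 * Real.pi ^ 2 * ν)) hlam hcont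
    (fun x hx => hasDerivWithinAt_energy ν hS (hc.hasDerivWithinAt_Ici hx) (hc.mem x) hgr)
    (fun x _ => energy_rhs_le hν (hc.mem x) (h0 x) hgr) ?_ ?_ (right_mem_Icc.2 ht.le)
  · rw [hc.initial]
    exact le_max_left _ _
  · refine le_trans ?_ (le_max_right _ _)
    rw [div_div, ← sq]
    exact div_le_div_of_nonneg_right hF2 (by positivity)


/-! ## The registered sub-goal: the uniform energy bound of the concrete orbit -/

/-- **Sub-goal of S3 (helper A, registered stub `krylovBogoliubov_orbitEnergyBound`)**: for `ν > 0`, `f ∈ L²` mean-zero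
and a mean-zero Galerkin datum `a` of order `N`, the coefficient orbit `φ_t(â|_{≤N})` of the level-`N` Galerkin system
driven by `f̂|_{≤N}` obeys `Σ_k ‖φ_t(â) k‖² ≤ max (Σ_k ‖â k‖²) (‖f‖₂²/(4π²ν)²)` for every `t` — the orbit never leaves
the larger of its initial energy sphere and the absorbing ball. [folklore] -/
theorem krylovBogoliubov_orbitEnergyBound : ∀ (ν : ℝ) (f a : UnitAddTorus (Fin 3) → EuclideanSpace ℝ (Fin 3)) (N : ℕ), 0 < ν → MemLp f 2 volume → Torus.HasZeroMean f → IsGalerkinMode N a → Torus.HasZeroMean a → ∀ t : ℝ, ∑ k, ‖galerkinCoeffFlow ν (fourierRestrict (Torus.freqBall N) f) t (fourierRestrict (Torus.freqBall N) a) k‖ ^ 2 ≤ max (∑ k, ‖fourierRestrict (Torus.freqBall N) a k‖ ^ 2) ((∫ x, ‖f x‖ ^ 2) / (4 * Real.pi ^ 2 * ν) ^ 2) := by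
  intro ν f a N hν hf2 hf0 ha ha0 t
  have hfi : Integrable f volume := hf2.integrable one_le_two
  have hc : IsGalerkinODESolution ν (fourierRestrict (Torus.freqBall N) f) (fourierRestrict (Torus.freqBall N) a)
      fun s => galerkinCoeffFlow ν (fourierRestrict (Torus.freqBall N) f) s (fourierRestrict (Torus.freqBall N) a) :=
    isGalerkinODESolution_galerkinCoeffFlow hν.le Torus.neg_mem_freqBall_of_mem (Torus.isRealCoeff_mFourierCoeff hfi)
      ha.fourierRestrict_mem
  have hneg : ∀ s, s ≤ 0 → (fun s => galerkinCoeffFlow ν (fourierRestrict (Torus.freqBall N) f) s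
      (fourierRestrict (Torus.freqBall N) a)) s = fourierRestrict (Torus.freqBall N) a :=
    fun s hs => galerkinCoeffFlow_of_nonpos hs
  exact energy_le_of_isGalerkinODESolution hν hf2 hc hneg (apply_zero_of_isGalerkinODESolution hfi hf0 ha ha0 hc hneg) t

end Summit.AnomalousDissipation.AnomalousDissipation.Theorems.GalerkinInvariantLoud.KrylovBogoliubov

end
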